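import Summits.QuantumFields.YangMills.Theorems.BalabanUVNodesN12WindowGaugeLetterUniformSocket
import Summits.QuantumFields.YangMills.Theorems.BalabanUVNodesN12WindowGaugeLetterUniformCanonicalPrelim
import HarnessLib

/-!
# BalabanUVNodes ∕ N12 — THE `k`-UNIFORM WINDOW GAUGE LETTER AT THE CANONICAL WINDOW: `hσW_uniform_of_plaqSmall` (p675589) with its six window rows
# `X D₀ hXΩ hBox hWX hfeedsX` DISCHARGED by lattice bookkeeping

Cell `pub-ymgap` (HUMAN RULINGS D-0062 ∕ D-0149), WIDTH SEAT `pub-ymgap-dag-n12-w6` g23 (node N12 = [B15]; key K1⁹ `stmt-QuantumFields-27364`, `--kind proof --supports … --as helper`;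
count-neutral).  THEOREMS ONLY (0 `def`, 0 `instance`, 0 `sorry`).  Door (j5) «canonical window» of this seat's HANDOFF (§g7 ∕ §g22).

WHAT.  The per-instance socket `N12WindowGaugeLetterUniformSocket.hσW_uniform_of_plaqSmall` (this seat's g7; consumed per instance by dag-n12-d's
`…Prop1DirectOfClassOnlyRowL1NearRadiusDatumScaleAtLengthWindowUniform` and displayed up to the junction of record v14ᴸ ✓p753865 :146–:156, :186) asks for an abstract WINDOW: a set `X` of fine
sites, a radius `D₀`, and four rows — `hXΩ` (every point of `X` within `D₀` steps of `Ω_k(Z)`), `hBox` (the `k`-blocks reached from `X` by words of length `≤ ℓ_k + m′L^k + L^k` have their bonds in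
the region box `[LO, HI]`), `hWX` ∕ `hfeedsX` (the corners of the window plaquettes ∕ the ends of the feeds of the window bonds lie in `X`).  ★★★ `hσW_uniform_canonical_of_plaqSmall` is the SAME
letter (same conclusion, token for token) at the CANONICAL window `X := {x | B^k(x) ∈ castSite '' [lo − 5, hi + 5]}`, `D₀ := 0`, where the four rows are PROVED from rows every instance has by
construction: ONE coarse-box geometry row `hΩ : castSite '' [lo − 5, hi + 5] ⊆ (Ω_k(Z))^{(k)}` (dag-n12-w4's `hΩw`, three blocks wider), two region-box MARGINS `LO + (2d + m′ + 2) ≤ lo − 5`,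
`hi + 6 + (2d + m′ + 2) ≤ HI` (replacing `hLO` ∕ `hHI`), the upper bound `hWsrc` of the plaquette window by its displayed lower bound (the `hWbox` fine box), and `hfit` at `D₀ := 0`.
v1.1 (§3, append-only): the canonical rows IMPLY the junction's displayed geometry rows — ★ `hΩw_of_hΩ` (dag-n12-w4's window-box row), ★ `hZ1_of_hΩ` (`Ω₁(Z)`-membership of the Λ-collar),
`hLO_of_hLOm`, `hHI_of_hHIm` — so a regenerated junction may display `hΩ`, `hLOm`, `hHIm`, `hWsrc` ALONE in place of `X D₀ hBox hWX hfeedsX hXΩ hΩw hZ1 hLO hHI`.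

The lattice bookkeeping lives in `…N12WindowGaugeLetterUniformCanonicalPrelim` (split off under the 400-line rule) on the cover `π : ℤᵈ → T_η` (r15 `B15Eq112TorusCover`, NODE 00 `TorusCoverLevels`): `B^k(π y) = castSite ⌊y ∕ L^k⌋` (`iterBlockOf_cover` by name), a representative
`y` of a fine site with PRESCRIBED block label (`exists_cover_eq_blockMap_eq`), the drift of the block label along a word (`exists_blockIter_walkEnd`: `|w| ≤ A·L^k ⇒` label moves by `≤ A`),
the corner blocks of the window plaquettes (`blockMap_add_mem_Icc_of_mem_fineBox`), the blocks read by the feeds of a `k`-bond (`blockIter_feeds_mem`: labels in `[z − 3, z + 3]`, from ρ5b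
`N12TowerProxiesOfClass.feeds_subset_boxBonds`), block unions (`mem_maxDomT_of_blockIter_eq`), and the reach numeric `ℓ_k + m′L^k + L^k ≤ (2d + m′ + 2)·L^k` (`reach_le_mul_pow`).

HONEST FRAMING.  Lattice bookkeeping by name over landed kernel theorems; the minimiser ([15] Thm 1 ∕ (E)), the plaquette letter, the region datum and the numerics stay HYPOTHESES exactly
as in p675589; nothing of Bałaban's estimates asserted or refuted; count-neutral; N12 NOT discharged; K1⁹ NOT closed; counts of record unmoved (typed 28∕28 · discharged 8∕27); one finite
𝕋⁴ programme at fixed `ε = L^{-K}` — R4 closes the conditional rung `BalabanLadder.UV` only; no summit statement is proved here and NOT the Yang–Mills mass gap (Clay); nothing continuum ∕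
ℝ⁴ ∕ OS.

References: [Balaban1989LargeFieldII] CMP 122 (1989) 355–392, (1.8) p.358; [Balaban1985Variational] CMP 102 (1985) 277–309, (2)–(4) p.278, Thm 1 (8) p.279, (16)–(18) p.280;
[Balaban1988Convergent] CMP 119 (1988) 243–285, (2.2) p.255, (2.11)–(2.13) pp.256–257, (2.16) p.257; [Balaban1987RG1] CMP 109 (1987) 249–301, (0.1) p.251.
-/

noncomputable section

open scoped Matrix.Norms.L2Operator BigOperators

namespace Summit.QuantumFields.YangMills.BalabanUVNodes.N12WindowGaugeLetterUniformCanonical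

open Literature.MathematicalPhysics.QuantumFieldTheory.Balaban1983to89
open T4Continuum GaugeField B15DeterminingSets BlockAveraging
open T4CubeChartGnomonic (SU2)
open B16Sect1Backgrounds (toMS)
open T4AxialGaugeSmallField (boxBonds castSite castSite_add_e)
open B16Eq18Proof (box mem_box)
open B14.Eq213MaximalDomains (side)
open B14.Eq213DetSet (Bj maxDomT)
open B14.Eq216Concrete (feeds)
open B14.Eq22Determines (blockIter)
open B15Eq112TorusCover (cover)
open B7Prop1Explicit (e e_apply)
open B8Eq17ClassAkV1 (plaqsOf)
open B15Prop1Carrier (plaqsInside)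
open ExpMeanLog (deltaSU)
open Literature.MathematicalPhysics.QuantumFieldTheory.BalabanImbrieJaffe1984to88.BIJ85Eq453GaugeField (qsstarGIter0)
open Literature.MathematicalPhysics.QuantumLattice (blockMap)
open Summit.QuantumFields.YangMills.BalabanUVNodes.N12WindowGaugeLetterUniformSocket (hσW_uniform_of_plaqSmall)
open Summit.QuantumFields.YangMills.BalabanUVNodes.N12WindowGaugeLetterUniformCanonicalPrelim (blockIter_cover_eq_castSite exists_blockIter_walkEnd
  blockMap_add_mem_Icc_of_mem_fineBox blockIter_feeds_mem mem_maxDomT_of_blockIter_eq reach_le_mul_pow)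

/-! ## §2 The window gauge letter (σ)_W of the direct road at the CANONICAL window -/

/-- ★★★ **THE `k`-UNIFORM WINDOW GAUGE LETTER (σ)_W AT THE CANONICAL WINDOW** — `hσW_uniform_of_plaqSmall` (p675589) with the six window rows `X D₀ hXΩ hBox hWX hfeedsX` DISCHARGED.  Per
instance: a residual gauge `σ` of the minimiser with the ROOT LETTER `hu`, `σ • U₀` bond-wise `δc`-near `1` on the four bonds of every plaquette of the window `Wp`, and `δW`-near `1` on the feeds of
the four bonds of every `(e₀, e_ν′)`-plaquette of the level-`k` window box `box (n+3) (lo−2)` — for ANY `δc, δW` dominating the `k`-FREE tolerance `((4d+m′+3)²·L²∕4 + 24·m′·((d+2)L)²∕4)·ε +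
m′·ρn` — from: ONE plaquette letter at level `k − 1`, the region datum letter on the box `[LO, HI]`, the numerics, and — in place of the abstract window — ONE coarse-box geometry row `hΩ` (the
`k`-sites `castSite '' [lo − 5, hi + 5]` lie in `(Ω_k(Z))^{(k)}`), two region-box MARGINS `hLOm` ∕ `hHIm` (`2d + m′ + 2` blocks beyond `[lo − 5, hi + 5]`, `+1` for the bond), the collar numeric
`hfit` (at `D₀ = 0`) and the upper bound `hWsrc` of the plaquette window by the `hWbox` fine box.  Inside: the window is `X := {x | B^k(x) ∈ castSite '' [lo − 5, hi + 5]}` ⊆ `Ω_k(Z)` (block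
union), the words of `hBox` drift by `≤ 2d + m′ + 2` blocks (`reach_le_mul_pow`), the plaquette corners land in blocks `[lo − 2, hi + 2]`, the feeds in blocks `[lo − 5, hi + 5]`.
[cite: Balaban1989LargeFieldII, (1.8) p.358; Balaban1985Variational, (4) p.278, Thm 1 (8) p.279, (16)–(18) p.280; Balaban1988Convergent, (2.2) p.255, (2.11)–(2.13) pp.256–257, (2.16) p.257] -/
theorem hσW_uniform_canonical_of_plaqSmall {F : T4Family} (ν : Node00.Stage7Numerics) (Kt : ℕ) (h0 : 0 < (F.P Kt).d) {k : ℕ} (hk0 : 0 < k) (hk : k ≤ (F.P Kt).m + (F.P Kt).K)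
    (hdiv : side (F.P Kt).L ν.M₁ k ∣ (F.P Kt).sitesPerDir 0) (Z : Set (Site (F.P Kt) 0))
    {c : ℕ} (hkc : k + c ≤ (F.P Kt).m + (F.P Kt).K) (hc : 4 * (F.P Kt).d + (3 * ((F.P Kt).d * (((F.P Kt).L - 1) / 2)) + 5) + 3 < 2 * (F.P Kt).L ^ c)
    {ρn : ℝ} (hρn : 0 ≤ ρn)
    -- the region datum letter on the region box `[LO, HI]`
    (W : GaugeField (F.P Kt) k SU2) (LO HI : Fin (F.P Kt).d → ℤ) (hD : ∀ b ∈ (boxBonds LO HI : Set (PBond (F.P Kt) k)), dist1 (W b) ≤ ρn)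
    {U₀ : GaugeField (F.P Kt) 0 SU2}
    (hmin : IsMinimizer (Node00.avOfRecord F 2 Kt) (Node00.regMSCoPOfRecord F 2 ν Kt k (maxDomT ν.M₁ Z)) (Bj ν.M₁ Z k)
      (avgFamily (Node00.avOfRecord F 2 Kt) (qsstarGIter0 k W)) U₀)
    {ε : ℝ} (hεpos : 0 < ε)
    -- ONE graded plaquette letter at level `k − 1` ([15] Thm 1 (8) ∕ the class), FREE `ε`, Prop. 2-small
    (hUk : PlaqSmallOn (plaqsOf (Node00.topSeq (Node00.suppDomOfRecord F ν Kt (maxDomT ν.M₁ Z)) (maxDomT ν.M₁ Z) (k - 1))) (ε * (F.P Kt).eta (k - 1) ^ 2) U₀)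
    (hα3 : (143 * (((((F.P Kt).d + 4 : ℕ) : ℝ)) ^ 2 / 4) ^ 2) * (ε * (F.P Kt).L ^ 2) ≤ 1 / 3)
    (hα2 : 2 * (ε * (F.P Kt).L ^ 2) ≤ 2 * deltaSU (Fin 2) / ((((F.P Kt).d + 4) * (F.P Kt).L : ℕ) : ℝ) ^ 2)
    (haN : (((((F.P Kt).d + 2) * (F.P Kt).L : ℕ) : ℝ) ^ 2 / 4) * (2 * (ε * (F.P Kt).L ^ 2)) < deltaSU (Fin 2))
    -- THE CANONICAL WINDOW: the level-`k` box `[lo, hi]`, ONE coarse-box geometry row, two region-box margins, the collar numeric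
    (lo hi : Fin (F.P Kt).d → ℤ) (hlohi : lo ≤ hi)
    (hΩ : ∀ z : Fin (F.P Kt).d → ℤ, (∀ κ, lo κ - 5 ≤ z κ ∧ z κ ≤ hi κ + 5) → (castSite z : Site (F.P Kt) k) ∈ pts k (maxDomT ν.M₁ Z k))
    (hLOm : ∀ κ, LO κ + ((2 * (F.P Kt).d + (3 * ((F.P Kt).d * (((F.P Kt).L - 1) / 2)) + 5) + 2 : ℕ) : ℤ) ≤ lo κ - 5)
    (hHIm : ∀ κ, hi κ + 6 + ((2 * (F.P Kt).d + (3 * ((F.P Kt).d * (((F.P Kt).L - 1) / 2)) + 5) + 2 : ℕ) : ℤ) ≤ HI κ)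
    (hfit : 3 * (∑ i ∈ Finset.range (k + 1), ((F.P Kt).d * (((F.P Kt).L ^ i - 1) / 2) + 1)) + ((3 * ((F.P Kt).d * (((F.P Kt).L - 1) / 2)) + 5) + 5) * (F.P Kt).L ^ k +
      (((F.P Kt).d + 4) * (F.P Kt).L + 2) * (∑ l ∈ Finset.Ico 0 k, (F.P Kt).L ^ l) + 4 ≤ (F.P Kt).L ^ (k - 1) * ν.M₁)
    -- the plaquette window, bounded ABOVE by the `hWbox` fine box
    (Wp : Finset (Plaq (F.P Kt) 0))
    (hWsrc : ∀ p ∈ Wp, p.src ∈ ((box (fun κ => (F.P Kt).L ^ k * ((hi κ - lo κ + 1).toNat + 3 + 1) - 1) (fun κ => ((F.P Kt).L : ℤ) ^ k * (lo κ - 2))).image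
      (fun z => (castSite z : Site (F.P Kt) 0))))
    -- any tolerances dominating the `k`-free window tolerance of `exists_windowGauge_uniform_le`
    {δc δW : ℝ}
    (hδc : ((((4 * (F.P Kt).d + (3 * ((F.P Kt).d * (((F.P Kt).L - 1) / 2)) + 5) + 3 : ℕ) : ℝ)) ^ 2 * ((F.P Kt).L : ℝ) ^ 2 / 4 + ((3 * ((F.P Kt).d * (((F.P Kt).L - 1) / 2)) + 5 : ℕ) : ℝ) * (24 * (((((F.P Kt).d + 2) * (F.P Kt).L : ℕ) : ℝ) ^ 2 / 4))) * ε + ((3 * ((F.P Kt).d * (((F.P Kt).L - 1) / 2)) + 5 : ℕ) : ℝ) * ρn ≤ δc)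
    (hδW : ((((4 * (F.P Kt).d + (3 * ((F.P Kt).d * (((F.P Kt).L - 1) / 2)) + 5) + 3 : ℕ) : ℝ)) ^ 2 * ((F.P Kt).L : ℝ) ^ 2 / 4 + ((3 * ((F.P Kt).d * (((F.P Kt).L - 1) / 2)) + 5 : ℕ) : ℝ) * (24 * (((((F.P Kt).d + 2) * (F.P Kt).L : ℕ) : ℝ) ^ 2 / 4))) * ε + ((3 * ((F.P Kt).d * (((F.P Kt).L - 1) / 2)) + 5 : ℕ) : ℝ) * ρn ≤ δW) :
    ∃ σ : GaugeTransf (F.P Kt) 0 SU2,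
      (∀ j, j ≤ k → ∀ b ∈ bondsOf (Bj ν.M₁ Z k j), toMS σ j b.src = 1 ∧ toMS σ j b.tgt = 1) ∧
      (∀ p ∈ Wp, ‖((gaugeAct σ U₀ ⟨p.src, p.μ⟩ : SU2) : Matrix (Fin 2) (Fin 2) ℂ) - 1‖ ≤ δc ∧ ‖((gaugeAct σ U₀ ⟨p.src.shift p.μ, p.ν⟩ : SU2) : Matrix (Fin 2) (Fin 2) ℂ) - 1‖ ≤ δc ∧
        ‖((gaugeAct σ U₀ ⟨p.src.shift p.ν, p.μ⟩ : SU2) : Matrix (Fin 2) (Fin 2) ℂ) - 1‖ ≤ δc ∧ ‖((gaugeAct σ U₀ ⟨p.src, p.ν⟩ : SU2) : Matrix (Fin 2) (Fin 2) ℂ) - 1‖ ≤ δc) ∧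
      (∀ (ν' : Fin (F.P Kt).d), ∀ z ∈ box (fun κ => (hi κ - lo κ + 1).toNat + 3) (fun κ => lo κ - 2), ∀ b₀ : PBond (F.P Kt) 0,
        (b₀ ∈ feeds k (⟨(castSite z : Site (F.P Kt) k), ⟨0, h0⟩⟩ : PBond (F.P Kt) k) ∨
          b₀ ∈ feeds k (⟨((castSite z : Site (F.P Kt) k)).shift ⟨0, h0⟩, ν'⟩ : PBond (F.P Kt) k) ∨
          b₀ ∈ feeds k (⟨((castSite z : Site (F.P Kt) k)).shift ν', ⟨0, h0⟩⟩ : PBond (F.P Kt) k) ∨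
          b₀ ∈ feeds k (⟨(castSite z : Site (F.P Kt) k), ν'⟩ : PBond (F.P Kt) k)) →
        ‖((gaugeAct σ U₀ b₀ : SU2) : Matrix (Fin 2) (Fin 2) ℂ) - 1‖ ≤ δW) := by
  classical
  -- the canonical window `X = {x | B^k(x) ∈ castSite '' [lo − 5, hi + 5]}`
  obtain ⟨X, hX⟩ : ∃ X : Set (Site (F.P Kt) 0), ∀ x, x ∈ X ↔
      ∃ z : Fin (F.P Kt).d → ℤ, (∀ i, lo i - 5 ≤ z i ∧ z i ≤ hi i + 5) ∧ blockIter k x = (castSite z : Site (F.P Kt) k) :=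
    ⟨{x | ∃ z : Fin (F.P Kt).d → ℤ, (∀ i, lo i - 5 ≤ z i ∧ z i ≤ hi i + 5) ∧ blockIter k x = (castSite z : Site (F.P Kt) k)}, fun _ => Iff.rfl⟩
  have hk1 : 1 ≤ k := hk0
  have hM1 : 1 ≤ ν.M₁ := by
    rcases Nat.eq_zero_or_pos ν.M₁ with h | h
    · rw [h, mul_zero] at hfit
      omega
    · exact h
  have he0 : ∀ μ κ : Fin (F.P Kt).d, (0 : ℤ) ≤ e μ κ := fun μ κ => by rw [e_apply]; split_ifs <;> norm_num
  have he1 : ∀ μ κ : Fin (F.P Kt).d, e μ κ ≤ (1 : ℤ) := fun μ κ => by rw [e_apply]; split_ifs <;> norm_num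
  -- (hXΩ) at `D₀ = 0`: every point of the window lies in `Ω_k(Z)` itself (block union)
  have hXΩ : ∀ x ∈ X, ∃ x₀ ∈ maxDomT ν.M₁ Z k, ∃ w₀ : List (Letter (F.P Kt).d), w₀.length ≤ 0 ∧ walkEnd x₀ w₀ = x := by
    intro x hx
    obtain ⟨z, hz, hxz⟩ := (hX x).1 hx
    exact ⟨x, mem_maxDomT_of_blockIter_eq hk1 hk hM1 hdiv hxz (hΩ z hz), [], le_rfl, rfl⟩
  have hfit0 : 0 + 3 * (∑ i ∈ Finset.range (k + 1), ((F.P Kt).d * (((F.P Kt).L ^ i - 1) / 2) + 1)) + ((3 * ((F.P Kt).d * (((F.P Kt).L - 1) / 2)) + 5) + 5) * (F.P Kt).L ^ k +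
      (((F.P Kt).d + 4) * (F.P Kt).L + 2) * (∑ l ∈ Finset.Ico 0 k, (F.P Kt).L ^ l) + 4 ≤ (F.P Kt).L ^ (k - 1) * ν.M₁ := by
    rw [zero_add]; exact hfit
  -- (hBox): the `k`-blocks reached from the window by the words of the letter have their bonds in the region box
  have hBox : ∀ x ∈ X, ∀ w : List (Letter (F.P Kt).d), w.length ≤ (∑ i ∈ Finset.range (k + 1), ((F.P Kt).d * (((F.P Kt).L ^ i - 1) / 2) + 1)) +
      (3 * ((F.P Kt).d * (((F.P Kt).L - 1) / 2)) + 5) * (F.P Kt).L ^ k + (F.P Kt).L ^ k →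
      ∀ μ : Fin (F.P Kt).d, (⟨blockIter k (walkEnd x w), μ⟩ : PBond (F.P Kt) k) ∈ (boxBonds LO HI : Set (PBond (F.P Kt) k)) := by
    intro x hx w hw μ
    obtain ⟨z, hz, hxz⟩ := (hX x).1 hx
    obtain ⟨z', hz', hblk⟩ := exists_blockIter_walkEnd hk hxz w (hw.trans (reach_le_mul_pow k))
    refine ⟨z', fun κ => ?_, fun κ => ?_, hblk⟩
    · have h1 := (hz' κ).1
      have h2 := (hz κ).1
      have h3 := hLOm κ
      linarith
    · have h1 := (hz' κ).2
      have h2 := (hz κ).2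
      have h3 := hHIm κ
      have h4 := he1 μ κ
      show z' κ + e μ κ ≤ HI κ
      linarith
  -- (hWX): the corners of the window plaquettes lie in the window
  have hcorner : ∀ p ∈ Wp, ∀ t : Fin (F.P Kt).d → ℤ, (∀ i, 0 ≤ t i) → (∀ i, t i ≤ 1) →
      ∃ zf : Fin (F.P Kt).d → ℤ, p.src = castSite zf ∧ cover (F.P Kt) (zf + t) ∈ X := by
    intro p hp t ht0 ht1
    obtain ⟨zf, hzf, hsrc⟩ := Finset.mem_image.1 (hWsrc p hp)
    refine ⟨zf, hsrc.symm, (hX _).2 ⟨blockMap ((F.P Kt).L ^ k) (zf + t), fun i => ?_, blockIter_cover_eq_castSite hk _⟩⟩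
    have h := blockMap_add_mem_Icc_of_mem_fineBox hlohi hzf t ht0 ht1 i
    constructor <;> linarith [h.1, h.2]
  have he2 : ∀ μ ν' κ : Fin (F.P Kt).d, μ ≠ ν' → e μ κ + e ν' κ ≤ (1 : ℤ) := by
    intro μ ν' κ hne
    rw [e_apply, e_apply]
    split_ifs with h1 h2
    · exact absurd (h1.symm.trans h2) hne
    · norm_num
    · norm_num
    · norm_num
  have hcov : ∀ zf : Fin (F.P Kt).d → ℤ, (castSite zf : Site (F.P Kt) 0) = cover (F.P Kt) zf := fun _ => rfl
  have hWX : ∀ p ∈ Wp, p.src ∈ X ∧ p.src.shift p.μ ∈ X ∧ p.src.shift p.ν ∈ X ∧ (p.src.shift p.μ).shift p.ν ∈ X ∧ (p.src.shift p.ν).shift p.μ ∈ X := by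
    intro p hp
    have hμν : p.μ ≠ p.ν := ne_of_lt p.hμν
    refine ⟨?_, ?_, ?_, ?_, ?_⟩
    · obtain ⟨zf, hsrc, h⟩ := hcorner p hp 0 (fun _ => le_rfl) (fun _ => zero_le_one)
      rwa [add_zero, ← hcov, ← hsrc] at h
    · obtain ⟨zf, hsrc, h⟩ := hcorner p hp (e p.μ) (he0 p.μ) (he1 p.μ)
      rwa [← hcov, castSite_add_e, ← hsrc] at h
    · obtain ⟨zf, hsrc, h⟩ := hcorner p hp (e p.ν) (he0 p.ν) (he1 p.ν)
      rwa [← hcov, castSite_add_e, ← hsrc] at h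
    · obtain ⟨zf, hsrc, h⟩ := hcorner p hp (e p.μ + e p.ν) (fun i => add_nonneg (he0 p.μ i) (he0 p.ν i)) (fun i => he2 p.μ p.ν i hμν)
      rwa [← add_assoc, ← hcov, castSite_add_e, castSite_add_e, ← hsrc] at h
    · obtain ⟨zf, hsrc, h⟩ := hcorner p hp (e p.ν + e p.μ) (fun i => add_nonneg (he0 p.ν i) (he0 p.μ i)) (fun i => he2 p.ν p.μ i hμν.symm)
      rwa [← add_assoc, ← hcov, castSite_add_e, castSite_add_e, ← hsrc] at h
  -- (hfeedsX): the feeds of the window bonds have their end-points in the window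
  have hfeeds : ∀ (c' : PBond (F.P Kt) k) (zc : Fin (F.P Kt).d → ℤ), c'.src = castSite zc → (∀ i, lo i - 2 ≤ zc i ∧ zc i ≤ hi i + 2) →
      ∀ b₀ : PBond (F.P Kt) 0, b₀ ∈ feeds k c' → b₀.src ∈ X ∧ b₀.tgt ∈ X := by
    intro c' zc hc' hzc b₀ hb₀
    obtain ⟨⟨z₁, hz₁, h₁⟩, ⟨z₂, hz₂, h₂⟩⟩ := blockIter_feeds_mem hk hc' hb₀
    exact ⟨(hX _).2 ⟨z₁, fun i => ⟨by linarith [(hz₁ i).1, (hzc i).1], by linarith [(hz₁ i).2, (hzc i).2]⟩, h₁⟩,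
      (hX _).2 ⟨z₂, fun i => ⟨by linarith [(hz₂ i).1, (hzc i).1], by linarith [(hz₂ i).2, (hzc i).2]⟩, h₂⟩⟩
  have hfeedsX : ∀ (ν' : Fin (F.P Kt).d), ∀ z ∈ box (fun κ => (hi κ - lo κ + 1).toNat + 3) (fun κ => lo κ - 2), ∀ b₀ : PBond (F.P Kt) 0,
      (b₀ ∈ feeds k (⟨(castSite z : Site (F.P Kt) k), ⟨0, h0⟩⟩ : PBond (F.P Kt) k) ∨
        b₀ ∈ feeds k (⟨((castSite z : Site (F.P Kt) k)).shift ⟨0, h0⟩, ν'⟩ : PBond (F.P Kt) k) ∨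
        b₀ ∈ feeds k (⟨((castSite z : Site (F.P Kt) k)).shift ν', ⟨0, h0⟩⟩ : PBond (F.P Kt) k) ∨
        b₀ ∈ feeds k (⟨(castSite z : Site (F.P Kt) k), ν'⟩ : PBond (F.P Kt) k)) → b₀.src ∈ X ∧ b₀.tgt ∈ X := by
    intro ν' z hz b₀ hb₀
    have hzb : ∀ i, lo i - 2 ≤ z i ∧ z i ≤ hi i + 1 := by
      intro i
      obtain ⟨h1, h2⟩ := (mem_box.1 hz) i
      have h1' : lo i - 2 ≤ z i := h1
      have h2' : z i < lo i - 2 + (((hi i - lo i + 1).toNat + 3 : ℕ) : ℤ) := h2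
      have h3 : (((hi i - lo i + 1).toNat + 3 : ℕ) : ℤ) = hi i - lo i + 1 + 3 := by
        push_cast
        rw [Int.toNat_of_nonneg (by linarith [hlohi i])]
      rw [h3] at h2'
      exact ⟨h1', by linarith⟩
    have hzs : ∀ (μ : Fin (F.P Kt).d) (i : Fin (F.P Kt).d), lo i - 2 ≤ (z + e μ) i ∧ (z + e μ) i ≤ hi i + 2 := by
      intro μ i
      show lo i - 2 ≤ z i + e μ i ∧ z i + e μ i ≤ hi i + 2
      exact ⟨by linarith [(hzb i).1, he0 μ i], by linarith [(hzb i).2, he1 μ i]⟩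
    have hz2 : ∀ i, lo i - 2 ≤ z i ∧ z i ≤ hi i + 2 := fun i => ⟨(hzb i).1, by linarith [(hzb i).2]⟩
    rcases hb₀ with h | h | h | h
    · exact hfeeds ⟨castSite z, ⟨0, h0⟩⟩ z rfl hz2 b₀ h
    · exact hfeeds ⟨(castSite z : Site (F.P Kt) k).shift ⟨0, h0⟩, ν'⟩ (z + e ⟨0, h0⟩) (by rw [castSite_add_e]) (hzs _) b₀ h
    · exact hfeeds ⟨(castSite z : Site (F.P Kt) k).shift ν', ⟨0, h0⟩⟩ (z + e ν') (by rw [castSite_add_e]) (hzs _) b₀ h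
    · exact hfeeds ⟨castSite z, ν'⟩ z rfl hz2 b₀ h
  exact hσW_uniform_of_plaqSmall ν Kt h0 hk0 hk hdiv Z hkc hc hρn W (boxBonds LO HI) hD hmin hεpos hUk hα3 hα2 haN X hXΩ hfit0 hBox lo hi Wp hWX
    hfeedsX hδc hδW

/-! ## §3 (v1.1) The canonical rows IMPLY the junction's displayed geometry rows: `hΩ ⇒ hΩw`, `hΩ ⇒ hZ1`, `hLOm ⇒ hLO`, `hHIm ⇒ hHI` -/

/-- ★ **`hΩ ⇒ hΩw`**: the ONE coarse-box row of the canonical window (`castSite '' [lo − 5, hi + 5] ⊆ (Ω_k(Z))^{(k)}`) implies dag-n12-w4's displayed window-box row `hΩw` of the junction of record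
(v14ᴸ ✓p753865: for every `z` of the level-`k` box `box (n+3) (lo−2)`, the sites `castSite z`, `castSite z + e₀`, `castSite z + e_ν′` lie in `(Ω_k(Z))^{(k)}`) — the three sites have labels in
`[lo − 2, hi + 2]`.  A regenerated junction over `hσW_uniform_canonical_of_plaqSmall` may therefore display `hΩ` alone. [cite: Balaban1988Convergent, (2.13) pp.256–257 (bookkeeping)] -/
theorem hΩw_of_hΩ {P : Params} (h0 : 0 < P.d) {k M₁ : ℕ} {Z : Set (Site P 0)} {lo hi : Fin P.d → ℤ} (hlohi : lo ≤ hi)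
    (hΩ : ∀ z : Fin P.d → ℤ, (∀ κ, lo κ - 5 ≤ z κ ∧ z κ ≤ hi κ + 5) → (castSite z : Site P k) ∈ pts k (maxDomT M₁ Z k)) :
    ∀ (ν' : Fin P.d), ∀ z ∈ box (fun κ => (hi κ - lo κ + 1).toNat + 3) (fun κ => lo κ - 2),
      (castSite z : Site P k) ∈ pts k (maxDomT M₁ Z k) ∧
        (castSite z : Site P k).shift ⟨0, h0⟩ ∈ pts k (maxDomT M₁ Z k) ∧
        (castSite z : Site P k).shift ν' ∈ pts k (maxDomT M₁ Z k) := by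
  intro ν' z hz
  have hzb : ∀ i, lo i - 2 ≤ z i ∧ z i ≤ hi i + 1 := by
    intro i
    obtain ⟨h1, h2⟩ := (mem_box.1 hz) i
    have h1' : lo i - 2 ≤ z i := h1
    have h2' : z i < lo i - 2 + (((hi i - lo i + 1).toNat + 3 : ℕ) : ℤ) := h2
    have h3 : (((hi i - lo i + 1).toNat + 3 : ℕ) : ℤ) = hi i - lo i + 1 + 3 := by
      push_cast
      rw [Int.toNat_of_nonneg (by linarith [hlohi i])]
    rw [h3] at h2'
    exact ⟨h1', by linarith⟩
  have he0 : ∀ μ κ : Fin P.d, (0 : ℤ) ≤ e μ κ := fun μ κ => by rw [e_apply]; split_ifs <;> norm_num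
  have he1 : ∀ μ κ : Fin P.d, e μ κ ≤ (1 : ℤ) := fun μ κ => by rw [e_apply]; split_ifs <;> norm_num
  have hsh : ∀ μ : Fin P.d, (castSite z : Site P k).shift μ ∈ pts k (maxDomT M₁ Z k) := by
    intro μ
    rw [← castSite_add_e]
    refine hΩ (z + e μ) fun κ => ?_
    show lo κ - 5 ≤ z κ + e μ κ ∧ z κ + e μ κ ≤ hi κ + 5
    exact ⟨by linarith [(hzb κ).1, he0 μ κ], by linarith [(hzb κ).2, he1 μ κ]⟩
  exact ⟨hΩ z fun κ => ⟨by linarith [(hzb κ).1], by linarith [(hzb κ).2]⟩, hsh _, hsh _⟩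

/-- ★ **`hΩ ⇒ hZ1`**: the ONE coarse-box row of the canonical window implies the junction's displayed row `hZ1` (a fine site whose `k`-block label lies in `castSite '' [lo − 1, hi + 1]` lies in
`Ω₁(Z)`): it lies in `Ω_k(Z)` (block union, `mem_maxDomT_of_blockIter_eq`) `⊆ Ω₁(Z)` (r11 `maxDomT_antitone`). [cite: Balaban1988Convergent, (2.13) pp.256–257 (bookkeeping)] -/
theorem hZ1_of_hΩ {P : Params} {k : ℕ} (hk0 : 0 < k) (hk : k ≤ P.m + P.K) {M₁ : ℕ} (hM : 1 ≤ M₁) {Z : Set (Site P 0)}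
    (hdiv : side P.L M₁ k ∣ P.sitesPerDir 0) {lo hi : Fin P.d → ℤ}
    (hΩ : ∀ z : Fin P.d → ℤ, (∀ κ, lo κ - 5 ≤ z κ ∧ z κ ≤ hi κ + 5) → (castSite z : Site P k) ∈ pts k (maxDomT M₁ Z k)) :
    ∀ y : Site P 0, blockIter k y ∈ (castSite '' Set.Icc (lo - 1) (hi + 1) : Set (Site P k)) → y ∈ maxDomT M₁ Z 1 := by
  rintro y ⟨z, ⟨hzl, hzu⟩, hyz⟩
  have hz : ∀ κ, lo κ - 5 ≤ z κ ∧ z κ ≤ hi κ + 5 := by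
    intro κ
    have h1 : lo κ - 1 ≤ z κ := hzl κ
    have h2 : z κ ≤ hi κ + 1 := hzu κ
    exact ⟨by linarith, by linarith⟩
  exact B14.Eq213DetSet.maxDomT_antitone hM Z hk0 (mem_maxDomT_of_blockIter_eq hk0 hk hM hdiv hyz.symm (hΩ z hz))

/-- `hLOm ⇒ hLO`: the lower margin row of the canonical window implies the junction's displayed row `hLO : LO ≤ lo − 1`. [cite: Balaban1989LargeFieldII, (1.8) p.358 (bookkeeping)] -/
theorem hLO_of_hLOm {d : ℕ} {LO lo : Fin d → ℤ} {A : ℕ} (hLOm : ∀ κ, LO κ + (A : ℤ) ≤ lo κ - 5) : LO ≤ lo - 1 := by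
  intro κ
  have h := hLOm κ
  have hA : (0 : ℤ) ≤ A := Nat.cast_nonneg A
  show LO κ ≤ lo κ - 1
  linarith

/-- `hHIm ⇒ hHI`: the upper margin row of the canonical window implies the junction's displayed row `hHI : hi + 1 ≤ HI`. [cite: Balaban1989LargeFieldII, (1.8) p.358 (bookkeeping)] -/
theorem hHI_of_hHIm {d : ℕ} {HI hi : Fin d → ℤ} {A : ℕ} (hHIm : ∀ κ, hi κ + 6 + (A : ℤ) ≤ HI κ) : hi + 1 ≤ HI := by
  intro κ
  have h := hHIm κ
  have hA : (0 : ℤ) ≤ A := Nat.cast_nonneg A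
  show hi κ + 1 ≤ HI κ
  linarith

end Summit.QuantumFields.YangMills.BalabanUVNodes.N12WindowGaugeLetterUniformCanonical

end
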